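import Summits.CriticalPhenomena.PercolationContinuityZ3.Theorems.Transplant.SkelNegBParamsFaceCountsRangeA
import Summits.CriticalPhenomena.PercolationContinuityZ3.Theorems.Transplant.SkelNegBParamsFaceRunA
import HarnessLib

/-!
# N1 params, M3 group G-fit — **THE x-FACE CROSS-LINK ROOMS `hfit`, `hq₃`** at the (ζ′) tuple, pinned at the M3 skeleton's choice functions:
# `qB + (NrX+1)·RA′ ≤ n_L` (one added served hypothesis `4·qB ≤ n_L` on the generic start half-width; G-O's `qBXF?` values meet it) and
# `W + (NrX+1)·RA′ + 2 ≤ qB3XA (RA′ mk)` — both `hfitX_RA`/`hq₃X_RA` (FaceRunA, stmt-g16) ∘ `NrX_range`/`counts_budget` (RangeA)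
(p3-g12, M3 pen, 2026-08-22; fields `FloorsX2.hfit/hq₃` (SkelPhiFaceNumsXP2 :83–:84) at M3-FLOORS-SIGNATURE §1).
builds on p205010 (kernel theorem, internal audit signed; external expert review pending) — nothing in this file uses p205010; NOTHING is claimed about the node
`SamePDropOfSkeletonNeg₁` (OPEN); arithmetic only.
Lane `prim-bschramm-*`, seat `prim-bschramm-p3` (gen 12); helper file (`--supports stmt-CriticalPhenomena-4575 --as helper`).
[cite: KozmaNitzan2024, §4 Lemma 12 (pp. 23–25)]
-/

noncomputable section

open scoped Classical

namespace Summit.CriticalPhenomena.PercolationContinuityZ3.Theorems.Transplant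

namespace PlanarSkeletonNeg

namespace NegB

open Literature.Probability.Percolation Literature.Probability.LatticeModels SimpleGraph
open Literature.Probability.Percolation.KozmaNitzan.Cells (oth sgOf sgOf_sign)
open SkelConc (Consts)
open Skelφ (shearUnit)
open Skelφ.StepI (DataN)
open TwoAxis.Para (modulus)
open Neg

namespace KS

section Fit

variable (κ : Consts) {V : Type} [DecidableEq V] [Countable V] {G : SimpleGraph V} [G.LocallyFinite] (Φ : PlanarSkeletonNeg G) (t : V)
  (p : unitInterval) (D : DataN V) (c mk g f : ℕ)

/-- **`hfit` pinned** at the M3 skeleton's choice functions (added served hypothesis `hq4 : 4·qB ≤ n_L`). [folklore] -/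
theorem hfit_XA (hN : EqNumL κ Φ t p D g f)
    (hnA : 2000 * Neg.Kq κ * (RA' κ Φ t p D mk + 2) ≤ nL κ Φ t p D g f)
    (x : Site 2) (du : MDir) (hd : du.1 = 0) (j : ℕ) (hj : j < (fcellsA κ Φ t p D g f).K) (z : Site 2) {E : ℕ}
    (hlev1 : (fcellsA κ Φ t p D g f).faceL 0 j - E ≤ (fcellsA κ Φ t p D g f).lev du x z) (hlev2 : (fcellsA κ Φ t p D g f).lev du x z ≤ (fcellsA κ Φ t p D g f).faceL 0 j + E)
    (hEu : (E : ℤ) ≤ u₀A κ Φ t p D g f)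
    (yL : Site 2) (he0 : |FcA κ Φ t p D g f (yTX0 κ Φ t p D g f yL (σTX κ Φ t p D g f yL x z))| ≤ 6 * u₀A κ Φ t p D g f) (qB : ℕ)
    (hq4 : 4 * qB ≤ nL κ Φ t p D g f) :
    (qB : ℤ) + (((NrX κ Φ t p D g f yL (σTX κ Φ t p D g f yL x z) x du z) : ℤ) + 1) * (RA' κ Φ t p D mk) ≤ (nL κ Φ t p D g f)  := by
  obtain ⟨-, hNr⟩ := NrX_range κ Φ t p D g f hN x du hd z hj hlev1 hlev2 yL (σTX κ Φ t p D g f yL x z) he0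
    (by linarith [(units_eqA κ Φ t p D g f).2.2.2.2.2.2.1])
  obtain ⟨hNr', -, -⟩ := counts_budget κ (N₃ := 0) hNr (by have := Neg.one_le_Kq κ; omega)
  exact hfitX_RA κ Φ t p D g f mk hq4 le_rfl hNr' hnA

/-- **`hq₃` pinned** at the M3 skeleton's choice functions. [folklore] -/
theorem hq₃_XA (hN : EqNumL κ Φ t p D g f)
    (x : Site 2) (du : MDir) (hd : du.1 = 0) (j : ℕ) (hj : j < (fcellsA κ Φ t p D g f).K) (z : Site 2) {E : ℕ}
    (hlev1 : (fcellsA κ Φ t p D g f).faceL 0 j - E ≤ (fcellsA κ Φ t p D g f).lev du x z) (hlev2 : (fcellsA κ Φ t p D g f).lev du x z ≤ (fcellsA κ Φ t p D g f).faceL 0 j + E)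
    (hEu : (E : ℤ) ≤ u₀A κ Φ t p D g f)
    (yL : Site 2) (he0 : |FcA κ Φ t p D g f (yTX0 κ Φ t p D g f yL (σTX κ Φ t p D g f yL x z))| ≤ 6 * u₀A κ Φ t p D g f) :
    (((nL κ Φ t p D g f) * (ℓL κ Φ t p D g f) / shearUnit (nL κ Φ t p D g f) (prFA κ Φ t p D g f).h + 1 : ℕ) : ℤ) + (((NrX κ Φ t p D g f yL (σTX κ Φ t p D g f yL x z) x du z) : ℤ) + 1) * (RA' κ Φ t p D mk) + 2 ≤ (qB3XA κ Φ t p D g f (RA' κ Φ t p D mk))  := by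
  obtain ⟨-, hNr⟩ := NrX_range κ Φ t p D g f hN x du hd z hj hlev1 hlev2 yL (σTX κ Φ t p D g f yL x z) he0
    (by linarith [(units_eqA κ Φ t p D g f).2.2.2.2.2.2.1])
  obtain ⟨hNr', -, -⟩ := counts_budget κ (N₃ := 0) hNr (by have := Neg.one_le_Kq κ; omega)
  exact hq₃X_RA κ Φ t p D g f (RA' κ Φ t p D mk) hNr'

end Fit

end KS

end NegB

end PlanarSkeletonNeg

end Summit.CriticalPhenomena.PercolationContinuityZ3.Theorems.Transplant

end
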